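import Mathlib
import Summits.NavierStokesRegularity.FluidComputer.TorusHighBandFluxCeiling
import Literature.Analysis.FunctionSpaces.TorusLerayHelmholtz
import HarnessLib

/-!
# The Fourier SHELL of a field on `T^d`: Parseval, enstrophy, Poincaré, and the shell transfer identity with its flux ceilings

HONEST FRAMING (cell `ns-blowup`, seat `ns-blowup-circuit` g6, human ruling D-0035): nothing here is a
claim about Navier–Stokes blow-up. WHAT THIS IS NOT: not a regularity criterion, not blow-up evidence.
Part 7 of the `TorusHighBand*` files (p445097 …): the per-BAND form of the coherence law. For band
edges `M₁ ≤ M₂` let `S v := P_{M₂} v − P_{M₁} v` be the Fourier SHELL `M₁² < |k|² ≤ M₂²` of `v` (an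
octave band of memo `CIRCUIT-OBSTRUCTIONS.md` §E, a «child band» of pub-fluidc's FC-TRIG bookkeeping),
`K_M = Torus.truncDerivBound M` the low-band ℓ¹-strain, `Q_M v = v − P_M v`.

* §1 slices (`v ∈ L²(T^d)`): Parseval for the shell (`integral_norm_sq_shell_eq_sum`,
  `integral_norm_sq_fourierTruncate_eq_add_shell`), enstrophy of the shell
  (`eGradNormSq_fourierTruncate_eq_add_shell`, shell Poincaré `shell_poincare`), the polarised
  antisymmetry `∫⟪a,(v·∇)b⟫ = −∫⟪b,(v·∇)a⟫` for weakly divergence-free `v`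
  (`integral_inner_convect_antisymm`), THE SHELL TRANSFER IDENTITY
  `∫⟪v,(v·∇)P₂v⟫ − ∫⟪v,(v·∇)P₁v⟫ = −∫⟪S v,(v·∇)P₁ v⟫ + ∫⟪Q₂ v,(v·∇)S v⟫` (`shellTransfer_eq`: the band
  is fed by LOW-band straining of itself and exchanges with the HIGHER band through its own strain) and
  the two ceilings `|∫⟪S v,(v·∇)P₁v⟫| ≤ K_{M₁}(v)‖S v‖₂‖v‖₂`,
  `|∫⟪Q₂v,(v·∇)S v⟫| ≤ (K_{M₁}(v) + K_{M₂}(v))‖Q₂ v‖₂‖v‖₂`;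
* §2 (sibling file `TorusShellEnergyIdentity`) along a Leray–Hopf solution: the EXACT shell energy
  identity `½‖S u(t)‖² + ν∫₀ᵗ‖∇S u‖₂² = ½‖S u₀‖² + ∫_{(0,t]} ( [∫⟪u,(u·∇)P₂u⟫ − ∫⟪u,(u·∇)P₁u⟫] + ∫⟪f, S u⟫ )`
  (difference of the tree's level identities `Torus.IsLerayHopfOn.integral_inner_fourierTruncate_self_eq`).

READING: the energy of a Fourier band of a real periodic Leray–Hopf flow changes only by (i) straining of
the band by the modes below it, at rate ≤ `K_{M₁}‖S u‖₂‖u‖₂`, (ii) exchange with the modes above it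
through the band's own (and lower) strain, at rate ≤ `(K_{M₁}+K_{M₂})‖Q_{M₂}u‖₂‖u‖₂`, (iii) the force,
(iv) its own dissipation `∈ [4π²ν(M₁²+1), 4π²νM₂²]·‖S u‖₂²`: a kernel-backed ceiling for the
«transfer efficiency» of any band-to-band hand-over. No definitions.
-/

noncomputable section

open MeasureTheory Set Filter UnitAddTorus Function
open scoped ENNReal NNReal InnerProductSpace RealInnerProductSpace

namespace Summit.NavierStokesRegularity.FluidComputer.TorusHighBandFluxCeiling

open Literature.Analysis Literature.Analysis.FunctionSpaces Literature.Analysis.FluidPDE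

variable {d : Type*} [Fintype d] [DecidableEq d]

/-! ## §1 Slice lemmas for the shell `S v = P_{M₂} v - P_{M₁} v` -/

section Slice

variable {v : UnitAddTorus d → EuclideanSpace ℝ d} {M₁ M₂ : ℕ}

/-- Fourier coefficients of the shell: `v̂(k)` on `ball M₂ \ ball M₁`, `0` elsewhere. [folklore] -/
theorem mFourierCoeff_shell (hv : Integrable v volume) (h : M₁ ≤ M₂) (k : d → ℤ) :
    mFourierCoeff (EuclideanSpace.complexify ∘ (Torus.fourierTruncate M₂ v - Torus.fourierTruncate M₁ v)) k =
      if k ∈ Torus.freqBall M₂ \ Torus.freqBall M₁ then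
        mFourierCoeff (EuclideanSpace.complexify ∘ v) k else 0 := by
  rw [Torus.complexify_comp_sub, Torus.mFourierCoeff_sub
      (Torus.integrable_complexify_comp (Torus.isSmooth_fourierTruncate M₂ v).integrable)
      (Torus.integrable_complexify_comp (Torus.isSmooth_fourierTruncate M₁ v).integrable),
    Torus.mFourierCoeff_fourierTruncate hv, Torus.mFourierCoeff_fourierTruncate hv]
  have hsub := Torus.freqBall_mono (d := d) h
  by_cases h2 : k ∈ Torus.freqBall M₂ <;> by_cases h1 : k ∈ Torus.freqBall M₁ <;>
    simp [h1, h2, Finset.mem_sdiff]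
  exact absurd (hsub h1) h2

/-- **Parseval for the shell**: `∫‖P₂v - P₁v‖² = ∑_{k ∈ ball M₂ \ ball M₁} ‖v̂(k)‖²`. [folklore] -/
theorem integral_norm_sq_shell_eq_sum (hv : MemLp v 2 volume) (h : M₁ ≤ M₂) :
    ∫ x, ‖Torus.fourierTruncate M₂ v x - Torus.fourierTruncate M₁ v x‖ ^ 2 =
      ∑ k ∈ Torus.freqBall M₂ \ Torus.freqBall M₁,
        ‖mFourierCoeff (EuclideanSpace.complexify ∘ v) k‖ ^ 2 := by
  classical
  have hS : MemLp (Torus.fourierTruncate M₂ v - Torus.fourierTruncate M₁ v) 2 volume :=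
    (Torus.memLp_fourierTruncate M₂ v 2).sub (Torus.memLp_fourierTruncate M₁ v 2)
  have hP := Torus.hasSum_sq_norm_mFourierCoeff_complexify hS
  simp_rw [mFourierCoeff_shell (hv.integrable one_le_two) h] at hP
  have hfin : HasSum (fun k => ‖(if k ∈ Torus.freqBall M₂ \ Torus.freqBall M₁ then
      mFourierCoeff (EuclideanSpace.complexify ∘ v) k else 0)‖ ^ 2)
      (∑ k ∈ Torus.freqBall M₂ \ Torus.freqBall M₁,
        ‖mFourierCoeff (EuclideanSpace.complexify ∘ v) k‖ ^ 2) := by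
    have h0 : HasSum (fun k => ‖(if k ∈ Torus.freqBall M₂ \ Torus.freqBall M₁ then
        mFourierCoeff (EuclideanSpace.complexify ∘ v) k else 0)‖ ^ 2)
        (∑ k ∈ Torus.freqBall M₂ \ Torus.freqBall M₁, ‖(if k ∈ Torus.freqBall M₂ \ Torus.freqBall M₁ then
          mFourierCoeff (EuclideanSpace.complexify ∘ v) k else 0)‖ ^ 2) :=
      hasSum_sum_of_ne_finset_zero (fun k hk => by rw [if_neg hk]; simp)
    rwa [Finset.sum_congr rfl (fun k hk => by rw [if_pos hk])] at h0
  have := hP.unique hfin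
  simpa only [Pi.sub_apply] using this

/-- **Pythagoras across the shell**: `∫‖P₂v‖² = ∫‖P₁v‖² + ∫‖P₂v - P₁v‖²` (`M₁ ≤ M₂`). [folklore] -/
theorem integral_norm_sq_fourierTruncate_eq_add_shell (hv : MemLp v 2 volume) (h : M₁ ≤ M₂) :
    ∫ x, ‖Torus.fourierTruncate M₂ v x‖ ^ 2 = (∫ x, ‖Torus.fourierTruncate M₁ v x‖ ^ 2) +
      ∫ x, ‖Torus.fourierTruncate M₂ v x - Torus.fourierTruncate M₁ v x‖ ^ 2 := by
  classical
  rw [Torus.integral_norm_sq_fourierTruncate (hv.integrable one_le_two) M₂,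
    Torus.integral_norm_sq_fourierTruncate (hv.integrable one_le_two) M₁,
    integral_norm_sq_shell_eq_sum hv h, add_comm, Finset.sum_sdiff (Torus.freqBall_mono h)]

/-- **Enstrophy splits across the shell**: `‖∇P₂v‖₂² = ‖∇P₁v‖₂² + ‖∇(P₂v - P₁v)‖₂²` in `ℝ≥0∞`. [folklore] -/
theorem eGradNormSq_fourierTruncate_eq_add_shell (hv : Integrable v volume) (h : M₁ ≤ M₂) :
    Torus.eGradNormSq (Torus.fourierTruncate M₂ v) = Torus.eGradNormSq (Torus.fourierTruncate M₁ v) +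
      Torus.eGradNormSq (Torus.fourierTruncate M₂ v - Torus.fourierTruncate M₁ v) := by
  classical
  rw [FluidPDE.Torus.eGradNormSq_fourierTruncate_eq_sum hv M₂,
    FluidPDE.Torus.eGradNormSq_fourierTruncate_eq_sum hv M₁, Torus.eGradNormSq_eq_tsum, ← mul_add]
  congr 1
  rw [tsum_eq_sum (s := Torus.freqBall M₂ \ Torus.freqBall M₁) (fun k hk => by
      rw [mFourierCoeff_shell hv h, if_neg hk]; simp)]
  rw [← Finset.sum_sdiff (Torus.freqBall_mono h), add_comm]
  congr 1
  refine Finset.sum_congr rfl fun k hk => ?_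
  rw [mFourierCoeff_shell hv h, if_pos hk]

/-- The shell enstrophy in closed form: `‖∇(P₂v - P₁v)‖₂² = 4π² ∑_{k ∈ ball M₂ \ ball M₁} |k|² ‖v̂(k)‖²`
(real number). [folklore] -/
theorem toReal_eGradNormSq_shell (hv : Integrable v volume) (h : M₁ ≤ M₂) :
    (Torus.eGradNormSq (Torus.fourierTruncate M₂ v - Torus.fourierTruncate M₁ v)).toReal =
      4 * Real.pi ^ 2 * ∑ k ∈ Torus.freqBall M₂ \ Torus.freqBall M₁,
        Torus.freqNormSq k * ‖mFourierCoeff (EuclideanSpace.complexify ∘ v) k‖ ^ 2 := by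
  classical
  rw [Torus.eGradNormSq_eq_tsum,
    tsum_eq_sum (s := Torus.freqBall M₂ \ Torus.freqBall M₁) (fun k hk => by
      rw [mFourierCoeff_shell hv h, if_neg hk]; simp)]
  rw [Finset.sum_congr rfl (fun k hk => by rw [mFourierCoeff_shell hv h, if_pos hk]),
    ENNReal.toReal_mul, ENNReal.toReal_ofReal (by positivity), ENNReal.toReal_sum (fun k _ =>
      ENNReal.mul_ne_top ENNReal.ofReal_ne_top (by simp))]
  congr 1
  refine Finset.sum_congr rfl fun k _ => ?_
  rw [ENNReal.toReal_mul, ENNReal.toReal_ofReal (Torus.freqNormSq_nonneg k), ← ofReal_norm,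
    ← ENNReal.ofReal_pow (norm_nonneg _), ENNReal.toReal_ofReal (by positivity)]

/-- **Shell Poincaré**: `4π²(M₁²+1) ∫‖P₂v - P₁v‖² ≤ ‖∇(P₂v - P₁v)‖₂² ≤ 4π²M₂² ∫‖P₂v - P₁v‖²` — the shell's
modes satisfy `M₁² + 1 ≤ |k|² ≤ M₂²`. [folklore] -/
theorem shell_poincare (hv : MemLp v 2 volume) (h : M₁ ≤ M₂) :
    4 * Real.pi ^ 2 * ((M₁ : ℝ) ^ 2 + 1) *
        ∫ x, ‖Torus.fourierTruncate M₂ v x - Torus.fourierTruncate M₁ v x‖ ^ 2 ≤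
      (Torus.eGradNormSq (Torus.fourierTruncate M₂ v - Torus.fourierTruncate M₁ v)).toReal ∧
    (Torus.eGradNormSq (Torus.fourierTruncate M₂ v - Torus.fourierTruncate M₁ v)).toReal ≤
      4 * Real.pi ^ 2 * (M₂ : ℝ) ^ 2 *
        ∫ x, ‖Torus.fourierTruncate M₂ v x - Torus.fourierTruncate M₁ v x‖ ^ 2 := by
  classical
  rw [toReal_eGradNormSq_shell (hv.integrable one_le_two) h, integral_norm_sq_shell_eq_sum hv h]
  set c : (d → ℤ) → ℝ := fun k => ‖mFourierCoeff (EuclideanSpace.complexify ∘ v) k‖ ^ 2 with hc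
  have hpi : 0 ≤ 4 * Real.pi ^ 2 := by positivity
  constructor
  · rw [mul_assoc, Finset.mul_sum]
    refine mul_le_mul_of_nonneg_left (Finset.sum_le_sum fun k hk => ?_) hpi
    exact mul_le_mul_of_nonneg_right
      (FluidPDE.Torus.sq_add_one_le_freqNormSq_of_not_mem (Finset.mem_sdiff.1 hk).2) (sq_nonneg _)
  · conv_rhs => rw [mul_assoc, Finset.mul_sum]
    refine mul_le_mul_of_nonneg_left (Finset.sum_le_sum fun k hk => ?_) hpi
    exact mul_le_mul_of_nonneg_right (Torus.mem_freqBall.1 (Finset.mem_sdiff.1 hk).1) (sq_nonneg _)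

/-- **Polarised antisymmetry of the trilinear form**: for `v ∈ L²(T^d)` weakly divergence free and smooth
`a, b`, `∫⟪a, (v·∇)b⟫ = -∫⟪b, (v·∇)a⟫` (polarise the diagonal identity
`Torus.integral_inner_self_convect_eq_zero_of_isWeaklyDivFree` at `a - b`). [folklore] -/
theorem integral_inner_convect_antisymm (hv : MemLp v 2 volume) (hdiv : Torus.IsWeaklyDivFree v)
    {a b : UnitAddTorus d → EuclideanSpace ℝ d} (ha : Torus.IsSmooth a) (hb : Torus.IsSmooth b) :
    ∫ x, ⟪a x, Torus.convect v b x⟫ = -∫ x, ⟪b x, Torus.convect v a x⟫ := by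
  have ham : MemLp a 2 volume := ha.memLp 2
  have hbm : MemLp b 2 volume := hb.memLp 2
  have h0 := FluidPDE.Torus.integral_inner_self_convect_eq_zero_of_isWeaklyDivFree hdiv (ha.sub hb)
  have haa := FluidPDE.Torus.integral_inner_self_convect_eq_zero_of_isWeaklyDivFree hdiv ha
  have hbb := FluidPDE.Torus.integral_inner_self_convect_eq_zero_of_isWeaklyDivFree hdiv hb
  have hpt : ∀ x, ⟪(a - b) x, Torus.convect v (a - b) x⟫ =
      (⟪a x, Torus.convect v a x⟫ - ⟪a x, Torus.convect v b x⟫) -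
        (⟪b x, Torus.convect v a x⟫ - ⟪b x, Torus.convect v b x⟫) := by
    intro x
    unfold Torus.convect
    rw [Torus.fderiv_sub (ha.isContDiff (by simp)) (hb.isContDiff (by simp))]
    simp only [Pi.sub_apply, _root_.sub_apply, inner_sub_left, inner_sub_right]
    ring
  simp_rw [hpt] at h0
  have iaa : Integrable (fun x => ⟪a x, Torus.convect v a x⟫) volume :=
    FluidPDE.Torus.integrable_inner_convect' ham hv ha
  have iab : Integrable (fun x => ⟪a x, Torus.convect v b x⟫) volume :=
    FluidPDE.Torus.integrable_inner_convect' ham hv hb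
  have iba : Integrable (fun x => ⟪b x, Torus.convect v a x⟫) volume :=
    FluidPDE.Torus.integrable_inner_convect' hbm hv ha
  have ibb : Integrable (fun x => ⟪b x, Torus.convect v b x⟫) volume :=
    FluidPDE.Torus.integrable_inner_convect' hbm hv hb
  have i1 : Integrable (fun x => ⟪a x, Torus.convect v a x⟫ - ⟪a x, Torus.convect v b x⟫) volume :=
    iaa.sub iab
  have i2 : Integrable (fun x => ⟪b x, Torus.convect v a x⟫ - ⟪b x, Torus.convect v b x⟫) volume :=
    iba.sub ibb
  rw [integral_sub i1 i2, integral_sub iaa iab, integral_sub iba ibb, haa, hbb] at h0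
  linarith

/-- **THE SHELL TRANSFER IDENTITY.** For `v ∈ L²(T^d)` weakly divergence free and `M₁ ≤ M₂`, with
`S = P₂v - P₁v`, `Q₂ = v - P₂v`:
`∫⟪v,(v·∇)P₂v⟫ - ∫⟪v,(v·∇)P₁v⟫ = -∫⟪S,(v·∇)P₁v⟫ + ∫⟪Q₂,(v·∇)S⟫` — the band is fed by LOW-band straining
of itself (first term) and exchanges with the HIGHER band through its own strain (second term); the
diagonal terms vanish. [folklore] -/
theorem shellTransfer_eq (hv : MemLp v 2 volume) (hdiv : Torus.IsWeaklyDivFree v) (M₁ M₂ : ℕ) :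
    (∫ x, ⟪v x, Torus.convect v (Torus.fourierTruncate M₂ v) x⟫) -
        ∫ x, ⟪v x, Torus.convect v (Torus.fourierTruncate M₁ v) x⟫ =
      -(∫ x, ⟪Torus.fourierTruncate M₂ v x - Torus.fourierTruncate M₁ v x,
          Torus.convect v (Torus.fourierTruncate M₁ v) x⟫) +
        ∫ x, ⟪v x - Torus.fourierTruncate M₂ v x,
          Torus.convect v (Torus.fourierTruncate M₂ v - Torus.fourierTruncate M₁ v) x⟫ := by
  set P₁ := Torus.fourierTruncate M₁ v with hP₁
  set P₂ := Torus.fourierTruncate M₂ v with hP₂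
  have h1s : Torus.IsSmooth P₁ := Torus.isSmooth_fourierTruncate M₁ v
  have h2s : Torus.IsSmooth P₂ := Torus.isSmooth_fourierTruncate M₂ v
  have hSs : Torus.IsSmooth (P₂ - P₁) := h2s.sub h1s
  have h1m : MemLp P₁ 2 volume := Torus.memLp_fourierTruncate M₁ v 2
  have h2m : MemLp P₂ 2 volume := Torus.memLp_fourierTruncate M₂ v 2
  have hSm : MemLp (P₂ - P₁) 2 volume := h2m.sub h1m
  have hQm : MemLp (v - P₂) 2 volume := hv.sub h2m
  -- `(v·∇)S = (v·∇)P₂ - (v·∇)P₁` pointwise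
  have hconv : ∀ x, Torus.convect v (P₂ - P₁) x = Torus.convect v P₂ x - Torus.convect v P₁ x := by
    intro x
    unfold Torus.convect
    rw [Torus.fderiv_sub (h2s.isContDiff (by simp)) (h1s.isContDiff (by simp)),
      _root_.sub_apply]
  -- left side `= ∫⟪v,(v·∇)S⟫`
  have hL : (∫ x, ⟪v x, Torus.convect v P₂ x⟫) - ∫ x, ⟪v x, Torus.convect v P₁ x⟫ =
      ∫ x, ⟪v x, Torus.convect v (P₂ - P₁) x⟫ := by
    rw [← integral_sub (FluidPDE.Torus.integrable_inner_convect' hv hv h2s)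
      (FluidPDE.Torus.integrable_inner_convect' hv hv h1s)]
    refine integral_congr_ae (ae_of_all _ fun x => ?_)
    simp only [hconv x, inner_sub_right]
  -- `v = S + P₁ + Q₂` and the diagonal term vanishes
  have hsplit : ∫ x, ⟪v x, Torus.convect v (P₂ - P₁) x⟫ =
      (∫ x, ⟪P₁ x, Torus.convect v (P₂ - P₁) x⟫) +
        ∫ x, ⟪v x - P₂ x, Torus.convect v (P₂ - P₁) x⟫ := by
    have hpt : ∀ x, ⟪v x, Torus.convect v (P₂ - P₁) x⟫ =
        ⟪(P₂ - P₁) x, Torus.convect v (P₂ - P₁) x⟫ +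
          (⟪P₁ x, Torus.convect v (P₂ - P₁) x⟫ + ⟪(v - P₂) x, Torus.convect v (P₂ - P₁) x⟫) := by
      intro x
      rw [← inner_add_left, ← inner_add_left]
      congr 1
      simp only [Pi.sub_apply]; abel
    simp_rw [hpt]
    have iS : Integrable (fun x => ⟪(P₂ - P₁) x, Torus.convect v (P₂ - P₁) x⟫) volume :=
      FluidPDE.Torus.integrable_inner_convect' hSm hv hSs
    have i1 : Integrable (fun x => ⟪P₁ x, Torus.convect v (P₂ - P₁) x⟫) volume :=
      FluidPDE.Torus.integrable_inner_convect' h1m hv hSs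
    have iQ : Integrable (fun x => ⟪(v - P₂) x, Torus.convect v (P₂ - P₁) x⟫) volume :=
      FluidPDE.Torus.integrable_inner_convect' hQm hv hSs
    have i1Q : Integrable (fun x => ⟪P₁ x, Torus.convect v (P₂ - P₁) x⟫ +
        ⟪(v - P₂) x, Torus.convect v (P₂ - P₁) x⟫) volume := i1.add iQ
    rw [integral_add iS i1Q,
      FluidPDE.Torus.integral_inner_self_convect_eq_zero_of_isWeaklyDivFree hdiv hSs, zero_add,
      integral_add i1 iQ]
    rfl
  rw [hL, hsplit, integral_inner_convect_antisymm hv hdiv h1s hSs]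
  simp only [Pi.sub_apply]

/-- **Ceiling for the low-band feed of the shell**: `|∫⟪S,(v·∇)P₁v⟫| ≤ K_{M₁}(v)·‖S‖₂·‖v‖₂`. [folklore] -/
theorem abs_integral_inner_shell_convect_low_le (hv : MemLp v 2 volume) (M₁ M₂ : ℕ) :
    |∫ x, ⟪Torus.fourierTruncate M₂ v x - Torus.fourierTruncate M₁ v x,
        Torus.convect v (Torus.fourierTruncate M₁ v) x⟫| ≤
      FluidPDE.Torus.truncDerivBound M₁ v *
        Real.sqrt (∫ x, ‖Torus.fourierTruncate M₂ v x - Torus.fourierTruncate M₁ v x‖ ^ 2) *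
          Real.sqrt (∫ x, ‖v x‖ ^ 2) := by
  set S := Torus.fourierTruncate M₂ v - Torus.fourierTruncate M₁ v with hS
  have hSm : MemLp S 2 volume := (Torus.memLp_fourierTruncate M₂ v 2).sub (Torus.memLp_fourierTruncate M₁ v 2)
  have hK := FluidPDE.Torus.truncDerivBound_nonneg M₁ v
  have hpt : ∀ x, ‖⟪S x, Torus.convect v (Torus.fourierTruncate M₁ v) x⟫‖ ≤
      FluidPDE.Torus.truncDerivBound M₁ v * (‖S x‖ * ‖v x‖) := by
    intro x; rw [Real.norm_eq_abs]
    calc |⟪S x, Torus.convect v (Torus.fourierTruncate M₁ v) x⟫|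
        ≤ ‖S x‖ * ‖Torus.convect v (Torus.fourierTruncate M₁ v) x‖ := abs_real_inner_le_norm _ _
      _ ≤ ‖S x‖ * (‖v x‖ * FluidPDE.Torus.truncDerivBound M₁ v) := by
          gcongr; exact FluidPDE.Torus.norm_fderiv_fourierTruncate_apply_le M₁ v x (v x)
      _ = _ := by ring
  have hprod : Integrable (fun x => ‖S x‖ * ‖v x‖) volume := hSm.norm.integrable_mul hv.norm
  have h1 : |∫ x, ⟪S x, Torus.convect v (Torus.fourierTruncate M₁ v) x⟫| ≤
      ∫ x, FluidPDE.Torus.truncDerivBound M₁ v * (‖S x‖ * ‖v x‖) := by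
    rw [← Real.norm_eq_abs]
    exact norm_integral_le_of_norm_le (hprod.const_mul _) (ae_of_all _ hpt)
  rw [integral_const_mul] at h1
  have h3 := integral_norm_mul_norm_le_sqrt hSm hv
  simp only [hS, Pi.sub_apply] at h1 h3 ⊢
  rw [mul_assoc]
  exact h1.trans (mul_le_mul_of_nonneg_left h3 hK)

/-- **Ceiling for the exchange of the shell with the higher band**:
`|∫⟪v - P₂v,(v·∇)S⟫| ≤ (K_{M₁}(v) + K_{M₂}(v))·‖v - P₂v‖₂·‖v‖₂`
(`‖(v·∇)S (x)‖ ≤ ‖(v·∇)P₂v (x)‖ + ‖(v·∇)P₁v (x)‖ ≤ ‖v x‖(K_{M₂} + K_{M₁})`). [folklore] -/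
theorem abs_integral_inner_high_convect_shell_le (hv : MemLp v 2 volume) (M₁ M₂ : ℕ) :
    |∫ x, ⟪v x - Torus.fourierTruncate M₂ v x,
        Torus.convect v (Torus.fourierTruncate M₂ v - Torus.fourierTruncate M₁ v) x⟫| ≤
      (FluidPDE.Torus.truncDerivBound M₁ v + FluidPDE.Torus.truncDerivBound M₂ v) *
        Real.sqrt (∫ x, ‖v x - Torus.fourierTruncate M₂ v x‖ ^ 2) * Real.sqrt (∫ x, ‖v x‖ ^ 2) := by
  set P₁ := Torus.fourierTruncate M₁ v with hP₁
  set P₂ := Torus.fourierTruncate M₂ v with hP₂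
  have hQm : MemLp (v - P₂) 2 volume := hv.sub (Torus.memLp_fourierTruncate M₂ v 2)
  have hK : 0 ≤ FluidPDE.Torus.truncDerivBound M₁ v + FluidPDE.Torus.truncDerivBound M₂ v :=
    add_nonneg (FluidPDE.Torus.truncDerivBound_nonneg M₁ v) (FluidPDE.Torus.truncDerivBound_nonneg M₂ v)
  have hconv : ∀ x, Torus.convect v (P₂ - P₁) x = Torus.convect v P₂ x - Torus.convect v P₁ x := by
    intro x
    unfold Torus.convect
    rw [Torus.fderiv_sub ((Torus.isSmooth_fourierTruncate M₂ v).isContDiff (by simp))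
      ((Torus.isSmooth_fourierTruncate M₁ v).isContDiff (by simp)), _root_.sub_apply]
  have hpt : ∀ x, ‖⟪v x - P₂ x, Torus.convect v (P₂ - P₁) x⟫‖ ≤
      (FluidPDE.Torus.truncDerivBound M₁ v + FluidPDE.Torus.truncDerivBound M₂ v) *
        (‖(v - P₂) x‖ * ‖v x‖) := by
    intro x; rw [Real.norm_eq_abs, hconv]
    have h2 := FluidPDE.Torus.norm_fderiv_fourierTruncate_apply_le M₂ v x (v x)
    have h1 := FluidPDE.Torus.norm_fderiv_fourierTruncate_apply_le M₁ v x (v x)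
    calc |⟪v x - P₂ x, Torus.convect v P₂ x - Torus.convect v P₁ x⟫|
        ≤ ‖v x - P₂ x‖ * ‖Torus.convect v P₂ x - Torus.convect v P₁ x‖ := abs_real_inner_le_norm _ _
      _ ≤ ‖v x - P₂ x‖ * (‖Torus.convect v P₂ x‖ + ‖Torus.convect v P₁ x‖) := by
          gcongr; exact norm_sub_le _ _
      _ ≤ ‖v x - P₂ x‖ * (‖v x‖ * FluidPDE.Torus.truncDerivBound M₂ v +
            ‖v x‖ * FluidPDE.Torus.truncDerivBound M₁ v) := by
          gcongr
          · exact h2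
          · exact h1
      _ = _ := by rw [Pi.sub_apply]; ring
  have hprod : Integrable (fun x => ‖(v - P₂) x‖ * ‖v x‖) volume := hQm.norm.integrable_mul hv.norm
  have h1 : |∫ x, ⟪v x - P₂ x, Torus.convect v (P₂ - P₁) x⟫| ≤
      ∫ x, (FluidPDE.Torus.truncDerivBound M₁ v + FluidPDE.Torus.truncDerivBound M₂ v) *
        (‖(v - P₂) x‖ * ‖v x‖) := by
    rw [← Real.norm_eq_abs]
    exact norm_integral_le_of_norm_le (hprod.const_mul _) (ae_of_all _ hpt)
  rw [integral_const_mul] at h1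
  have h3 := integral_norm_mul_norm_le_sqrt hQm hv
  simp only [Pi.sub_apply] at h1 h3
  rw [mul_assoc]
  exact h1.trans (mul_le_mul_of_nonneg_left h3 hK)

end Slice

end Summit.NavierStokesRegularity.FluidComputer.TorusHighBandFluxCeiling
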